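import Mathlib

/-!
# Generic leaf-nondegeneracy (stub B of crux `WindLine.WindyGalerkinSteadyZerothLaw`,
# stmt-AnomalousDissipation-11414), tools G: surjectivity is open; finite codimension is filled at
# a finite stage of an approximating sequence

Helper layer (pure proof file, no definitions; abstract functional analysis):

* `exists_surjective_nhds` — **surjectivity is an open condition**: if `A : E →L F` between Banach
  spaces is onto, every `A'` with `‖A' − A‖` small is onto (Banach's open mapping theorem gives
  preimages of controlled norm, `ContinuousLinearMap.exists_preimage_norm_le`; then successive
  approximation `y_{n+1} = (A − A') x_n`, `A x_n = y_n`, `x = ∑ x_n`);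
* `exists_sup_range_eq_top` — **finite codimension is filled at a finite stage**: if `R` is a closed
  subspace with a finite-dimensional complement and `P_N` are continuous linear maps with increasing
  ranges and `P_N y → y` for every `y`, then `R ⊔ range P_N = ⊤` for some `N` (the subspaces
  `R ⊔ range P_N` are closed — finite-codimensional over the closed `R` — increase, stabilise since the
  quotient is finite-dimensional, and their union is dense).

References: Brezis, *Functional Analysis*, Thm. 2.6 and Rem. 2.5 (open mapping and its stability);
Kato, *Perturbation Theory for Linear Operators*, IV §5.
-/

noncomputable section

-- D-0017: single-problem summit ⇒ the duplicated namespace segment is by design.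
set_option linter.dupNamespace false

open scoped Topology NNReal
open Filter Set Function

namespace Summit.AnomalousDissipation.AnomalousDissipation.Theorems.WindLineWindyGalerkinSteadyZerothLaw.GenericLeaf

/-! ## §1 Surjectivity is open -/

section Surjective

variable {E F : Type*} [NormedAddCommGroup E] [NormedSpace ℝ E] [CompleteSpace E]
  [NormedAddCommGroup F] [NormedSpace ℝ F] [CompleteSpace F]

omit [CompleteSpace F] in
/-- **Successive approximation.**  Let `s` be a (non-linear) right inverse of `A` with
`‖s y‖ ≤ M‖y‖`, and let `‖A − A'‖ M ≤ θ < 1`.  Then every `y` is `A' x` for the absolutely convergent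
series `x = ∑ s(yₙ)`, `y₀ = y`, `y_{n+1} = (A − A')(s yₙ)`. [folklore] -/
theorem surjective_of_rightInverse_of_norm_sub_le (A A' : E →L[ℝ] F) {M θ : ℝ} (hM : 0 ≤ M) (hθ0 : 0 ≤ θ)
    (hθ : θ < 1) (s : F → E) (hs : ∀ y, A (s y) = y) (hsn : ∀ y, ‖s y‖ ≤ M * ‖y‖)
    (hA : ‖A - A'‖ * M ≤ θ) : Function.Surjective A' := by
  intro y
  -- the sequences
  set ys : ℕ → F := fun n => Nat.rec y (fun _ w => (A - A') (s w)) n with hys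
  have hys0 : ys 0 = y := rfl
  have hysS : ∀ n, ys (n + 1) = (A - A') (s (ys n)) := fun n => rfl
  have hyn : ∀ n, ‖ys n‖ ≤ θ ^ n * ‖y‖ := by
    intro n
    induction n with
    | zero => simp [hys0]
    | succ n ih =>
      rw [hysS]
      calc ‖(A - A') (s (ys n))‖ ≤ ‖A - A'‖ * ‖s (ys n)‖ := (A - A').le_opNorm _
        _ ≤ ‖A - A'‖ * (M * ‖ys n‖) := mul_le_mul_of_nonneg_left (hsn _) (norm_nonneg _)
        _ = (‖A - A'‖ * M) * ‖ys n‖ := by ring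
        _ ≤ θ * (θ ^ n * ‖y‖) := mul_le_mul hA ih (norm_nonneg _) hθ0
        _ = θ ^ (n + 1) * ‖y‖ := by ring
  set xs : ℕ → E := fun n => s (ys n) with hxs
  have hxn : ∀ n, ‖xs n‖ ≤ M * ‖y‖ * θ ^ n := fun n => by
    calc ‖xs n‖ ≤ M * ‖ys n‖ := hsn _
      _ ≤ M * (θ ^ n * ‖y‖) := mul_le_mul_of_nonneg_left (hyn n) hM
      _ = M * ‖y‖ * θ ^ n := by ring
  have hsum : Summable xs :=
    Summable.of_norm_bounded ((summable_geometric_of_lt_one hθ0 hθ).mul_left (M * ‖y‖)) hxn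
  refine ⟨∑' n, xs n, ?_⟩
  -- `A' xₙ = yₙ − yₙ₊₁`, and the telescoping sum is `y`
  have hAx : ∀ n, A' (xs n) = ys n - ys (n + 1) := fun n => by
    rw [hysS, hxs]
    change A' (s (ys n)) = ys n - (A (s (ys n)) - A' (s (ys n)))
    rw [hs]
    abel
  have h1 : HasSum (fun n => A' (xs n)) (A' (∑' n, xs n)) := (hsum.hasSum).mapL A'
  have h2 : Tendsto (fun n => ∑ i ∈ Finset.range n, A' (xs i)) atTop (𝓝 (A' (∑' n, xs n))) := h1.tendsto_sum_nat
  have h3 : Tendsto (fun n => ∑ i ∈ Finset.range n, A' (xs i)) atTop (𝓝 (y - 0)) := by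
    have e : ∀ n, ∑ i ∈ Finset.range n, A' (xs i) = ys 0 - ys n := fun n => by
      simp_rw [hAx]
      exact Finset.sum_range_sub' ys n
    simp_rw [e, hys0]
    refine tendsto_const_nhds.sub ?_
    rw [tendsto_zero_iff_norm_tendsto_zero]
    refine squeeze_zero (fun n => norm_nonneg _) hyn ?_
    have h := (tendsto_pow_atTop_nhds_zero_of_lt_one hθ0 hθ).mul_const ‖y‖
    rwa [zero_mul] at h
  rw [sub_zero] at h3
  exact tendsto_nhds_unique h2 h3

/-- **Surjectivity is an open condition** (stability of the open mapping theorem): a surjective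
continuous linear map between Banach spaces has a neighbourhood, in operator norm, of surjective
maps. [folklore] -/
theorem exists_surjective_nhds (A : E →L[ℝ] F) (hA : Function.Surjective A) :
    ∃ δ : ℝ, 0 < δ ∧ ∀ A' : E →L[ℝ] F, ‖A' - A‖ < δ → Function.Surjective A' := by
  obtain ⟨M, hM0, hpre⟩ := A.exists_preimage_norm_le hA
  choose s hs hsn using hpre
  refine ⟨(2 * M)⁻¹, by positivity, fun A' hA' => ?_⟩
  refine surjective_of_rightInverse_of_norm_sub_le A A' hM0.le (by norm_num : (0 : ℝ) ≤ 1 / 2) (by norm_num)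
    s hs hsn ?_
  rw [norm_sub_rev] at hA'
  have h : ‖A - A'‖ * M ≤ (2 * M)⁻¹ * M := mul_le_mul_of_nonneg_right hA'.le hM0.le
  have e : (2 * M)⁻¹ * M = 1 / 2 := by field_simp
  linarith

end Surjective

/-! ## §2 Finite codimension is filled at a finite stage -/

section FiniteStage

variable {E : Type*} [NormedAddCommGroup E] [NormedSpace ℝ E]

/-- **A closed finite-codimensional subspace plus the ranges of a strongly convergent increasing
sequence of maps is everything at a finite stage.** [folklore] -/
theorem exists_sup_range_eq_top (R C : Submodule ℝ E) (hRc : IsClosed (R : Set E)) [FiniteDimensional ℝ C]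
    (hRC : IsCompl R C) (P : ℕ → E →L[ℝ] E)
    (hmono : Monotone fun N => LinearMap.range ((P N : E →L[ℝ] E) : E →ₗ[ℝ] E))
    (hlim : ∀ y, Tendsto (fun N => P N y) atTop (𝓝 y)) :
    ∃ N, R ⊔ LinearMap.range ((P N : E →L[ℝ] E) : E →ₗ[ℝ] E) = ⊤ := by
  haveI : FiniteDimensional ℝ (E ⧸ R) := LinearEquiv.finiteDimensional (Submodule.quotientEquivOfIsCompl R C hRC).symm
  -- the increasing chain `V N = R ⊔ range P_N` and its image in the quotient
  set V : ℕ →o Submodule ℝ E := ⟨fun N => R ⊔ LinearMap.range ((P N : E →L[ℝ] E) : E →ₗ[ℝ] E),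
    fun a b hab => sup_le_sup_left (hmono hab) _⟩ with hV
  set Vq : ℕ →o Submodule ℝ (E ⧸ R) := ⟨fun N => (V N).map R.mkQ, fun a b hab => Submodule.map_mono (V.monotone hab)⟩
    with hVq
  obtain ⟨N₀, hN₀⟩ := (monotone_stabilizes_iff_noetherian.2 inferInstance) Vq
  have hstab : ∀ N, N₀ ≤ N → V N = V N₀ := by
    intro N hN
    have h := hN₀ N hN
    have e : ∀ M, V M = (Vq M).comap R.mkQ := fun M => by
      change V M = ((V M).map R.mkQ).comap R.mkQ
      rw [Submodule.comap_map_mkQ]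
      exact (sup_eq_right.2 le_sup_left).symm
    rw [e N, e N₀, h]
  -- `V N₀` is closed and dense
  have hclosed : IsClosed ((V N₀ : Submodule ℝ E) : Set E) :=
    Submodule.isClosed_mono_of_finiteDimensional_quotient hRc le_sup_left
  refine ⟨N₀, Submodule.eq_top_iff'.2 fun y => ?_⟩
  change y ∈ V N₀
  have hmem : y ∈ closure ((V N₀ : Submodule ℝ E) : Set E) := by
    refine mem_closure_of_tendsto (hlim y) (eventually_atTop.2 ⟨N₀, fun N hN => ?_⟩)
    rw [← hstab N hN]
    exact Submodule.mem_sup_right ⟨y, rfl⟩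
  rwa [hclosed.closure_eq] at hmem

end FiniteStage

/-! ## §3 Registered sub-goal -/

/-- **Registered sub-goal `genericLeaf_toolsG`** (worker B of stub `stub_genericLeafNondegeneracy`):
surjectivity of continuous linear maps between Banach spaces is open in operator norm,
`exists_surjective_nhds` in Pi-form. [folklore] -/
theorem genericLeaf_toolsG : ∀ {E F : Type*} [NormedAddCommGroup E] [NormedSpace ℝ E] [CompleteSpace E] [NormedAddCommGroup F] [NormedSpace ℝ F] [CompleteSpace F] (A : E →L[ℝ] F), Function.Surjective A → ∃ δ : ℝ, 0 < δ ∧ ∀ A' : E →L[ℝ] F, ‖A' - A‖ < δ → Function.Surjective A' :=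
  fun A hA => exists_surjective_nhds A hA

end Summit.AnomalousDissipation.AnomalousDissipation.Theorems.WindLineWindyGalerkinSteadyZerothLaw.GenericLeaf

end
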